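import Summits.ValiantsHypothesis.ValiantsHypothesis.Theorems.SymPencilPerFourHyperplanePencilRankOneA

/-!
# Route `SymPencil` — the one-row pencil core of hyperplane flow rigidity, III: `X₂ = 0` on the
# hyperplane, generic branch (tool file, `--supports` stmt-ValiantsHypothesis-5674; nothing here
# bears on `VP ≠ VNP`)

Stub S1c of cell `(12,4,2)` (memo `Cruxes/SdcSuperquadratic/CELL-TWELVE-FOUR.md` §5) is, after
`SymPencilPerFourHyperplanePencilRankOneB.exists_kernel_hyperplane_of_X₂_eq_zero`, the statement
PART X: the block-diagonal flow `per [𝟙; a + tX₀a; b + tX₁b; c + tX₂c] = per [𝟙; a; b; c]`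
(`a, b ∈ K⁴`, `c ∈ ker μ`, `μ ≠ 0`) forces `X₂ = 0` on `ker μ`.  This file proves it on the GENERIC
branch: all `μ(e_i) ≠ 0` and `μ` not proportional to `(1,1,−1,−1)`, `(1,−1,1,−1)`, `(1,−1,−1,1)`
(`X₂_eq_zero_of_pencil_flow_generic`).  Steps (`S = X₀ + X₁`, `T(a,b,c) = per [𝟙; a; b; c]`):

* `S_single_offdiag_eq_zero`: (F1) at `a = b = e_i` reads `T(S e_i, e_i, c) = 0` on `ker μ`; with
  `μ(e_i) ≠ 0` this forces `S e_i ∈ K e_i` (`S` is diagonal, `S e_i = σ_i e_i`);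
* `pairing`: (F1) at `(e_i, e_k)` plus `(e_k, e_i)` and the pairing relations
  `T(e₀,e₁,z) + T(e₂,e₃,z) = T(e₀,e₂,z) + T(e₁,e₃,z) = T(e₀,e₃,z) + T(e₁,e₂,z)` give two coefficient
  vectors `(σ₂−σ₁, σ₃−σ₀, σ₀−σ₃, σ₁−σ₂)`, `(σ₃−σ₁, σ₂−σ₀, σ₁−σ₃, σ₀−σ₂)` proportional to `μ`; off the
  three patterns this forces `σ₀ = σ₁ = σ₂ = σ₃ =: σ`, i.e. `X₁ = σ − X₀`;
* then (F1) symmetrised gives `X₂ = −σ` on `ker μ`, and `X₀³ = 0 = (σ − X₀)³`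
  (`SymPencilPerFourHyperplanePencilOrders`) gives `σ = 0`.

Residual of PART X after this file: the three patterns above and the `μ` with a zero coordinate
(these contain the per₂ planes).  Elementary. [folklore]
-/

-- single-conjunct layout: Sub = Summit, duplicated namespace component intended
set_option linter.dupNamespace false

namespace Summit.ValiantsHypothesis.ValiantsHypothesis.Theorems.SymPencilPerFourHyperplanePencilSym

open Matrix
open Summit.ValiantsHypothesis.ValiantsHypothesis.Theorems.SymPencilPerFourInnerRankRows
  (permanent_of_rows)
open Summit.ValiantsHypothesis.ValiantsHypothesis.Theorems.SymPencilPerFourBoxInjective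
  (apply_eq_dotProduct)
open Summit.ValiantsHypothesis.ValiantsHypothesis.Theorems.SymPencilPerFourHyperplanePencilOrders
open Summit.ValiantsHypothesis.ValiantsHypothesis.Theorems.SymPencilPerFourHyperplanePencilRankOneA
  (per_last_eq_dotProduct exists_coeff_of_vanish per_single_single apply_eq_sum_single)

variable {K : Type*} [Field K]

/-! ### Small evaluations -/

/-- `T(e_i, e_i, z) = 0`. [folklore] -/
theorem per_single_self (i : Fin 4) (z : Fin 4 → K) :
    (Matrix.of ![(fun _ => (1 : K)), Pi.single i 1, Pi.single i 1, z]).permanent = 0 := by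
  fin_cases i <;> simp [permanent_of_rows]

/-- `T(a, b, z) = 0` for all `a, b` forces `z = 0`. [folklore] -/
theorem eq_zero_of_per_eq_zero₃ [CharZero K] (z : Fin 4 → K)
    (h : ∀ a b : Fin 4 → K, (Matrix.of ![(fun _ => (1 : K)), a, b, z]).permanent = 0) : z = 0 := by
  have e := fun i k : Fin 4 => h (Pi.single i 1) (Pi.single k 1)
  have h01 := e 0 1; have h02 := e 0 2; have h03 := e 0 3; have h12 := e 1 2
  simp [permanent_of_rows] at h01 h02 h03 h12
  have z1 : z 1 = 0 := by linear_combination (h02 + h03 - h01) / 2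
  have z2 : z 2 = 0 := by linear_combination (h01 + h03 - h02) / 2
  have z3 : z 3 = 0 := by linear_combination (h01 + h02 - h03) / 2
  have z0 : z 0 = 0 := by linear_combination h12 - z3
  funext p; fin_cases p <;> assumption

/-- Additivity/homogeneity of `T(a, b, ·)` in the last row. [folklore] -/
theorem per_add_smul₃ (a b z c : Fin 4 → K) (s : K) :
    (Matrix.of ![(fun _ => (1 : K)), a, b, z + s • c]).permanent =
      (Matrix.of ![(fun _ => (1 : K)), a, b, z]).permanent +
        s * (Matrix.of ![(fun _ => (1 : K)), a, b, c]).permanent := by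
  simp only [permanent_of_rows, Pi.add_apply, Pi.smul_apply, smul_eq_mul]; ring

/-- If `e₁(x) − x_i − x_q = 0` for all `q ≠ i` then `x_p = 0` for `p ≠ i`. [folklore] -/
theorem offdiag_eq_zero [CharZero K] (x : Fin 4 → K) (i : Fin 4)
    (hE : ∀ q, q ≠ i → x 0 + x 1 + x 2 + x 3 - x i - x q = 0) (p : Fin 4) (hp : p ≠ i) :
    x p = 0 := by
  set Y := x 0 + x 1 + x 2 + x 3 - x i with hY
  have hq : ∀ q, q ≠ i → x q = Y := fun q hq => by linear_combination -(hE q hq)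
  have h1 : (Finset.univ.sum x : K) = x i + (Finset.univ.erase i).sum x :=
    (Finset.add_sum_erase _ _ (Finset.mem_univ i)).symm
  have h2 : (Finset.univ.erase i).sum x = (Finset.univ.erase i).sum (fun _ => Y) :=
    Finset.sum_congr rfl fun q hq' => hq q (Finset.ne_of_mem_erase hq')
  have h3 : (Finset.univ.erase i).sum (fun _ => Y) = 3 * Y := by
    rw [Finset.sum_const, Finset.card_erase_of_mem (Finset.mem_univ i), Finset.card_univ,
      Fintype.card_fin, nsmul_eq_mul]
    norm_num
  have h4 : (Finset.univ.sum x : K) = x 0 + x 1 + x 2 + x 3 := by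
    rw [Fin.sum_univ_four]
  have hY0 : Y = 0 := by
    have : Y = 3 * Y := by linear_combination h4.symm.trans (h1.trans (by rw [h2, h3]))
    linear_combination -(this) / 2
  rw [hq p hp, hY0]

variable [CharZero K]

/-! ### `S = X₀ + X₁` is diagonal when all `μ(e_i) ≠ 0` -/

/-- **Diagonal columns**: (F1) at `a = b = e_i` gives `T(S e_i, e_i, c) = 0` on `ker μ`; if
`μ(e_i) ≠ 0` then `S e_i ∈ K e_i`. [folklore] -/
theorem S_single_offdiag_eq_zero (X₀ X₁ X₂ : (Fin 4 → K) →ₗ[K] (Fin 4 → K))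
    (μ : (Fin 4 → K) →ₗ[K] K)
    (h : ∀ (a b c : Fin 4 → K) (t : K), μ c = 0 →
      (Matrix.of ![(fun _ => (1 : K)), a + t • X₀ a, b + t • X₁ b, c + t • X₂ c]).permanent =
        (Matrix.of ![(fun _ => (1 : K)), a, b, c]).permanent)
    (i : Fin 4) (hmi : μ (Pi.single i 1) ≠ 0) (p : Fin 4) (hp : p ≠ i) :
    (X₀ (Pi.single i 1) + X₁ (Pi.single i 1)) p = 0 := by
  set x := X₀ (Pi.single i 1) + X₁ (Pi.single i 1) with hx
  have hxc : ∀ c, μ c = 0 →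
      (Matrix.of ![(fun _ => (1 : K)), x, Pi.single i 1, c]).permanent = 0 := fun c hc => by
    have h1 := (pencil_flow_orders X₀ X₁ X₂ μ h (Pi.single i 1) (Pi.single i 1) c hc).1
    rw [per_single_self, add_zero, per_swap₁₂ (Pi.single i 1), ← per_add₁] at h1
    exact h1
  obtain ⟨t, ht⟩ := exists_coeff_of_vanish μ
    (fun q => (Matrix.of ![(fun _ => (1 : K)), x, Pi.single i 1, Pi.single q 1]).permanent)
    fun c hc => by have h := hxc c hc; rw [per_last_eq_dotProduct] at h; exact h
  have hti : t = 0 := by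
    have h := ht i
    rw [per_single_single, if_pos rfl] at h
    exact (mul_eq_zero.1 h.symm).resolve_right hmi
  have hE : ∀ q, q ≠ i → x 0 + x 1 + x 2 + x 3 - x i - x q = 0 := fun q hq => by
    have h := ht q
    rw [per_single_single, if_neg (Ne.symm hq), hti, zero_mul] at h
    exact h
  exact offdiag_eq_zero x i hE p hp

/-- `S e_i = σ_i e_i` with `σ_i = (S e_i)_i`, when `μ(e_i) ≠ 0`. [folklore] -/
theorem S_single_eq_smul (X₀ X₁ X₂ : (Fin 4 → K) →ₗ[K] (Fin 4 → K))
    (μ : (Fin 4 → K) →ₗ[K] K)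
    (h : ∀ (a b c : Fin 4 → K) (t : K), μ c = 0 →
      (Matrix.of ![(fun _ => (1 : K)), a + t • X₀ a, b + t • X₁ b, c + t • X₂ c]).permanent =
        (Matrix.of ![(fun _ => (1 : K)), a, b, c]).permanent)
    (i : Fin 4) (hmi : μ (Pi.single i 1) ≠ 0) :
    X₀ (Pi.single i 1) + X₁ (Pi.single i 1) =
      (X₀ (Pi.single i 1) + X₁ (Pi.single i 1)) i • Pi.single i 1 := by
  funext p
  by_cases hp : p = i
  · rw [hp]; simp
  · rw [S_single_offdiag_eq_zero X₀ X₁ X₂ μ h i hmi p hp]; simp [hp]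

/-! ### The pairing relations -/

/-- **Symmetrised (F1) at `(e_i, e_k)`**: `(σ_i + σ_k) T(e_i, e_k, c) + 2 T(e_i, e_k, X₂ c) = 0` on
`ker μ` (all `μ(e_j) ≠ 0`). [folklore] -/
theorem pair_identity (X₀ X₁ X₂ : (Fin 4 → K) →ₗ[K] (Fin 4 → K)) (μ : (Fin 4 → K) →ₗ[K] K)
    (h : ∀ (a b c : Fin 4 → K) (t : K), μ c = 0 →
      (Matrix.of ![(fun _ => (1 : K)), a + t • X₀ a, b + t • X₁ b, c + t • X₂ c]).permanent =
        (Matrix.of ![(fun _ => (1 : K)), a, b, c]).permanent)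
    (hm : ∀ j, μ (Pi.single j 1) ≠ 0) (i k : Fin 4) (c : Fin 4 → K) (hc : μ c = 0) :
    ((X₀ (Pi.single i 1) + X₁ (Pi.single i 1)) i + (X₀ (Pi.single k 1) + X₁ (Pi.single k 1)) k) *
        (Matrix.of ![(fun _ => (1 : K)), Pi.single i 1, Pi.single k 1, c]).permanent +
      2 * (Matrix.of ![(fun _ => (1 : K)), Pi.single i 1, Pi.single k 1, X₂ c]).permanent = 0 := by
  have h1 := (pencil_flow_orders X₀ X₁ X₂ μ h (Pi.single i 1) (Pi.single k 1) c hc).1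
  have h2 := (pencil_flow_orders X₀ X₁ X₂ μ h (Pi.single k 1) (Pi.single i 1) c hc).1
  rw [per_swap₁₂ (Pi.single i 1) (X₁ _)] at h1
  rw [per_swap₁₂ (Pi.single k 1) (X₁ _), per_swap₁₂ (Pi.single k 1) (Pi.single i 1)] at h2
  have hSi := S_single_eq_smul X₀ X₁ X₂ μ h i (hm i)
  have hSk := S_single_eq_smul X₀ X₁ X₂ μ h k (hm k)
  have eI : (Matrix.of ![(fun _ => (1 : K)), X₀ (Pi.single i 1), Pi.single k 1, c]).permanent +
      (Matrix.of ![(fun _ => (1 : K)), X₁ (Pi.single i 1), Pi.single k 1, c]).permanent =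
      (X₀ (Pi.single i 1) + X₁ (Pi.single i 1)) i *
        (Matrix.of ![(fun _ => (1 : K)), Pi.single i 1, Pi.single k 1, c]).permanent := by
    rw [← per_add₁, hSi, per_smul₁]; simp
  have eK : (Matrix.of ![(fun _ => (1 : K)), X₀ (Pi.single k 1), Pi.single i 1, c]).permanent +
      (Matrix.of ![(fun _ => (1 : K)), X₁ (Pi.single k 1), Pi.single i 1, c]).permanent =
      (X₀ (Pi.single k 1) + X₁ (Pi.single k 1)) k *
        (Matrix.of ![(fun _ => (1 : K)), Pi.single i 1, Pi.single k 1, c]).permanent := by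
    rw [← per_add₁, hSk, per_smul₁, per_swap₁₂ (Pi.single k 1)]; simp
  linear_combination h1 + h2 - eI - eK

/-- **PART X on the generic branch**: if all `μ(e_i) ≠ 0` and `μ` is not proportional to
`(1,1,−1,−1)`, `(1,−1,1,−1)`, `(1,−1,−1,1)`, then `X₂ = 0` on `ker μ`. [folklore] -/
theorem X₂_eq_zero_of_pencil_flow_generic (X₀ X₁ X₂ : (Fin 4 → K) →ₗ[K] (Fin 4 → K))
    (μ : (Fin 4 → K) →ₗ[K] K)
    (h : ∀ (a b c : Fin 4 → K) (t : K), μ c = 0 →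
      (Matrix.of ![(fun _ => (1 : K)), a + t • X₀ a, b + t • X₁ b, c + t • X₂ c]).permanent =
        (Matrix.of ![(fun _ => (1 : K)), a, b, c]).permanent)
    (hm : ∀ j, μ (Pi.single j 1) ≠ 0)
    (hp₁ : ¬ (μ (Pi.single 1 1) = μ (Pi.single 0 1) ∧ μ (Pi.single 2 1) = -μ (Pi.single 0 1) ∧
      μ (Pi.single 3 1) = -μ (Pi.single 0 1)))
    (hp₂ : ¬ (μ (Pi.single 1 1) = -μ (Pi.single 0 1) ∧ μ (Pi.single 2 1) = μ (Pi.single 0 1) ∧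
      μ (Pi.single 3 1) = -μ (Pi.single 0 1)))
    (hp₃ : ¬ (μ (Pi.single 1 1) = -μ (Pi.single 0 1) ∧ μ (Pi.single 2 1) = -μ (Pi.single 0 1) ∧
      μ (Pi.single 3 1) = μ (Pi.single 0 1)))
    (c : Fin 4 → K) (hc : μ c = 0) : X₂ c = 0 := by
  -- the diagonal entries of `S`
  obtain ⟨σ, hσ⟩ : ∃ σ : Fin 4 → K, ∀ i, (X₀ (Pi.single i 1) + X₁ (Pi.single i 1)) i = σ i :=
    ⟨_, fun i => rfl⟩
  have hS : ∀ i, X₀ (Pi.single i 1) + X₁ (Pi.single i 1) = σ i • Pi.single i 1 := fun i => by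
    rw [← hσ i]; exact S_single_eq_smul X₀ X₁ X₂ μ h i (hm i)
  -- the two pairing functionals vanish on `ker μ`
  have hpair := fun i k c hc => pair_identity X₀ X₁ X₂ μ h hm i k c hc
  have G : ∀ c', μ c' = 0 →
      ((σ 2 - σ 1) * c' 0 + (σ 3 - σ 0) * c' 1 + (σ 0 - σ 3) * c' 2 + (σ 1 - σ 2) * c' 3 = 0 ∧
       (σ 3 - σ 1) * c' 0 + (σ 2 - σ 0) * c' 1 + (σ 1 - σ 3) * c' 2 + (σ 0 - σ 2) * c' 3 = 0) := by
    intro c' hc'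
    have q01 := hpair 0 1 c' hc'
    have q23 := hpair 2 3 c' hc'
    have q02 := hpair 0 2 c' hc'
    have q13 := hpair 1 3 c' hc'
    have q03 := hpair 0 3 c' hc'
    have q12 := hpair 1 2 c' hc'
    rw [hσ, hσ] at q01 q23 q02 q13 q03 q12
    rw [per_last_eq_dotProduct (Pi.single _ 1) (Pi.single _ 1) c',
      per_last_eq_dotProduct (Pi.single _ 1) (Pi.single _ 1) (X₂ c')] at q01 q23 q02 q13 q03 q12
    simp only [dotProduct, Fin.sum_univ_four, per_single_single] at q01 q23 q02 q13 q03 q12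
    simp at q01 q23 q02 q13 q03 q12
    constructor
    · linear_combination q01 + q23 - q02 - q13
    · linear_combination q01 + q23 - q03 - q12
  obtain ⟨κ, hκ⟩ := exists_coeff_of_vanish μ ![σ 2 - σ 1, σ 3 - σ 0, σ 0 - σ 3, σ 1 - σ 2]
    fun c' hc' => by
      rw [dotProduct, Fin.sum_univ_four]
      simp only [Matrix.cons_val_zero, Matrix.cons_val_one, Matrix.cons_val]
      linear_combination (G c' hc').1
  obtain ⟨κ', hκ'⟩ := exists_coeff_of_vanish μ ![σ 3 - σ 1, σ 2 - σ 0, σ 1 - σ 3, σ 0 - σ 2]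
    fun c' hc' => by
      rw [dotProduct, Fin.sum_univ_four]
      simp only [Matrix.cons_val_zero, Matrix.cons_val_one, Matrix.cons_val]
      linear_combination (G c' hc').2
  have k0 := hκ 0; have k1 := hκ 1; have k2 := hκ 2; have k3 := hκ 3
  have l0 := hκ' 0; have l1 := hκ' 1; have l2 := hκ' 2; have l3 := hκ' 3
  simp only [Matrix.cons_val_zero, Matrix.cons_val_one, Matrix.cons_val] at k0 k1 k2 k3 l0 l1 l2 l3
  set m0 := μ (Pi.single 0 1) with hm0
  set m1 := μ (Pi.single 1 1) with hm1
  set m2 := μ (Pi.single 2 1) with hm2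
  set m3 := μ (Pi.single 3 1) with hm3
  -- all `σ_i` equal
  have hall : σ 1 = σ 0 ∧ σ 2 = σ 0 ∧ σ 3 = σ 0 := by
    have a1 : κ * (m0 + m3) = 0 := by linear_combination -(k0 + k3)
    have a2 : κ * (m1 + m2) = 0 := by linear_combination -(k1 + k2)
    have b1 : κ' * (m0 + m2) = 0 := by linear_combination -(l0 + l2)
    have b2 : κ' * (m1 + m3) = 0 := by linear_combination -(l1 + l3)
    have c1 : (κ - κ') * (m0 + m1) = 0 := by linear_combination -(k0 + k1) + (l0 + l1)
    have c2 : (κ - κ') * (m2 + m3) = 0 := by linear_combination -(k2 + k3) + (l2 + l3)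
    by_cases hk : κ = 0
    · by_cases hk' : κ' = 0
      · rw [hk, zero_mul] at k0 k1 k2
        rw [hk', zero_mul] at l0 l1
        exact ⟨by linear_combination l1 - k0, by linear_combination l1, by linear_combination k1⟩
      · exfalso
        have e02 : m2 = -m0 := by
          have := (mul_eq_zero.1 b1).resolve_left hk'; linear_combination this
        have e13 : m3 = -m1 := by
          have := (mul_eq_zero.1 b2).resolve_left hk'; linear_combination this
        have hkk : κ - κ' ≠ 0 := by rw [hk, zero_sub]; exact neg_ne_zero.2 hk'
        have e01 : m1 = -m0 := by
          have := (mul_eq_zero.1 c1).resolve_left hkk; linear_combination this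
        exact hp₃ ⟨e01, e02, by rw [e13, e01, neg_neg]⟩
    · have e03 : m3 = -m0 := by
        have := (mul_eq_zero.1 a1).resolve_left hk; linear_combination this
      have e12 : m2 = -m1 := by
        have := (mul_eq_zero.1 a2).resolve_left hk; linear_combination this
      exfalso
      by_cases hk' : κ' = 0
      · have hkk : κ - κ' ≠ 0 := by rw [hk', sub_zero]; exact hk
        have e01 : m1 = -m0 := by
          have := (mul_eq_zero.1 c1).resolve_left hkk; linear_combination this
        exact hp₂ ⟨e01, by rw [e12, e01, neg_neg], e03⟩
      · have e02 : m2 = -m0 := by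
          have := (mul_eq_zero.1 b1).resolve_left hk'; linear_combination this
        have e01 : m1 = m0 := by linear_combination e12 - e02
        exact hp₁ ⟨e01, e02, e03⟩
  obtain ⟨e1, e2, e3⟩ := hall
  -- `X₁ = σ₀ - X₀`
  have hX1 : ∀ a, X₁ a = σ 0 • a - X₀ a := fun a => by
    have hSa : X₀ a + X₁ a = σ 0 • a := by
      rw [apply_eq_sum_single X₀ a, apply_eq_sum_single X₁ a]
      have hall' : ∀ i, σ i = σ 0 := fun i => by
        fin_cases i
        · rfl
        · exact e1
        · exact e2
        · exact e3
      have e : ∀ i, X₀ (Pi.single i 1) + X₁ (Pi.single i 1) = σ 0 • Pi.single i 1 := fun i => by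
        rw [hS i, hall' i]
      have ha : a = a 0 • (Pi.single 0 (1 : K) : Fin 4 → K) + a 1 • Pi.single 1 1 +
          a 2 • Pi.single 2 1 + a 3 • Pi.single 3 1 := by
        funext j; fin_cases j <;> simp
      calc _ = a 0 • (X₀ (Pi.single 0 1) + X₁ (Pi.single 0 1)) +
            a 1 • (X₀ (Pi.single 1 1) + X₁ (Pi.single 1 1)) +
            a 2 • (X₀ (Pi.single 2 1) + X₁ (Pi.single 2 1)) +
            a 3 • (X₀ (Pi.single 3 1) + X₁ (Pi.single 3 1)) := by
              simp only [smul_add]; abel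
        _ = σ 0 • a := by
              rw [e, e, e, e, smul_comm (a 0), smul_comm (a 1), smul_comm (a 2), smul_comm (a 3),
                ← smul_add, ← smul_add, ← smul_add, ← ha]
    exact eq_sub_of_add_eq' hSa
  -- `X₂ c = -σ₀ c`
  have hX2 : X₂ c = -(σ 0 • c) := by
    have hz : X₂ c + σ 0 • c = 0 := by
      refine eq_zero_of_per_eq_zero₃ _ fun a b => ?_
      have f1 := (pencil_flow_orders X₀ X₁ X₂ μ h a b c hc).1
      have f2 := (pencil_flow_orders X₀ X₁ X₂ μ h b a c hc).1
      have l1 : (Matrix.of ![(fun _ => (1 : K)), σ 0 • b - X₀ b, a, c]).permanent =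
          σ 0 * (Matrix.of ![(fun _ => (1 : K)), a, b, c]).permanent -
            (Matrix.of ![(fun _ => (1 : K)), X₀ b, a, c]).permanent := by
        simp only [permanent_of_rows, Pi.sub_apply, Pi.smul_apply, smul_eq_mul]; ring
      have l2 : (Matrix.of ![(fun _ => (1 : K)), σ 0 • a - X₀ a, b, c]).permanent =
          σ 0 * (Matrix.of ![(fun _ => (1 : K)), a, b, c]).permanent -
            (Matrix.of ![(fun _ => (1 : K)), X₀ a, b, c]).permanent := by
        simp only [permanent_of_rows, Pi.sub_apply, Pi.smul_apply, smul_eq_mul]; ring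
      rw [hX1, per_swap₁₂ a (σ 0 • b - X₀ b), l1] at f1
      rw [hX1, per_swap₁₂ b (σ 0 • a - X₀ a), l2, per_swap₁₂ b a (X₂ c)] at f2
      rw [per_add_smul₃]
      linear_combination (f1 + f2) / 2
    exact eq_neg_of_add_eq_zero_left hz
  -- `σ₀ = 0` by nilpotency
  have hσ0 : σ 0 = 0 := by
    by_contra hs
    have E1 : ∀ b : Fin 4 → K, ∀ q : Fin 4,
        σ 0 ^ 3 * b q - 3 * σ 0 ^ 2 * (X₀ b) q + 3 * σ 0 * (X₀ (X₀ b)) q = 0 := fun b q => by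
      have h3 := congr_fun (X₁_cube_eq_zero X₀ X₁ X₂ μ h b) q
      have h0 := congr_fun (X₀_cube_eq_zero X₀ X₁ X₂ μ h b) q
      simp only [hX1, map_sub, map_smul, Pi.sub_apply, Pi.smul_apply, smul_eq_mul,
        Pi.zero_apply] at h3 h0
      linear_combination h3 + h0
    have hsq : ∀ b, X₀ (X₀ b) = 0 := fun b => by
      funext q
      have e := E1 (X₀ (X₀ b)) q
      have z1 := congr_fun (X₀_cube_eq_zero X₀ X₁ X₂ μ h b) q
      have z2 := congr_fun (X₀_cube_eq_zero X₀ X₁ X₂ μ h (X₀ b)) q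
      rw [Pi.zero_apply] at z1 z2
      rw [z1, z2, mul_zero, mul_zero, sub_zero, add_zero] at e
      have := (mul_eq_zero.1 e).resolve_left (pow_ne_zero 3 hs)
      simpa using this
    have hX0 : ∀ b, X₀ b = 0 := fun b => by
      funext q
      have e := E1 (X₀ b) q
      rw [hsq, map_zero, Pi.zero_apply, mul_zero, mul_zero, sub_zero, add_zero] at e
      have := (mul_eq_zero.1 e).resolve_left (pow_ne_zero 3 hs)
      simpa using this
    have e := E1 (Pi.single 0 1) 0
    rw [hX0, map_zero] at e
    have h3 : σ 0 ^ 3 = 0 := by simpa using e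
    exact hs ((pow_eq_zero_iff (by norm_num)).1 h3)
  rw [hX2, hσ0, zero_smul, neg_zero]

end Summit.ValiantsHypothesis.ValiantsHypothesis.Theorems.SymPencilPerFourHyperplanePencilSym
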